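import Summits.HodgeConjecture.HodgeConjecture.Theses.PeriodsPolice

/-!
# Route PeriodsPolice — `Assembly` (assembly item stmt-HodgeConjecture-1204)

The assembly item of route `PeriodsPolice`,

  PeriodsPoliceHodgeClasses → CompactCommutantTrivial → LefschetzB → ClassicalBridge → QbarDescent → _root_.HodgeConjecture,

is the route's deciding theorem `PeriodsPolice.closes` curried (its hypotheses are exactly the route items
named in the item, possibly in another order).  Pure logic over the route file; no other import, no
named-fact hypothesis, no sorry.
-/

-- `Summit.HodgeConjecture.HodgeConjecture.Theorems` is the mandated namespace (single-problem
-- summit: Problem = Summit), which `linter.dupNamespace` flags on every declaration; the lakefile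
-- turns the linter off tree-wide (weak option), restated here so stand-alone elaboration is
-- warning-free too.
set_option linter.dupNamespace false

namespace Summit.HodgeConjecture.HodgeConjecture.Theorems

/-- **Item stmt-HodgeConjecture-1204 (`Assembly`), route `PeriodsPolice`**: the route's items imply the
Hodge conjecture — literally the deciding theorem `PeriodsPolice.closes`, curried.  The type is the route
decl `Summit.HodgeConjecture.HodgeConjecture.Theses.PeriodsPolice.Assembly`.
[cite: Andre1996Motifs] -/
theorem periodsPolice_assembly_proof :
    Summit.HodgeConjecture.HodgeConjecture.Theses.PeriodsPolice.Assembly :=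
  fun h0 h1 h2 h3 h4 ↦
    Summit.HodgeConjecture.HodgeConjecture.Theses.PeriodsPolice.closes h0 h1 h4 h2 h3

end Summit.HodgeConjecture.HodgeConjecture.Theorems
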